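import Literature.Computability.Complexity.GraphCanonizationProgramRun
import Literature.Computability.Complexity.GraphCanonizationProgramSize
import Literature.Computability.Complexity.CodeFPInvFolds
import HarnessLib

/-!
# Canonical forms of coloured graphs in simply exponential time: the fact discharged

**`babaiLuks1983_canonicalForm_holds`** — the named fact `babaiLuks1983_canonicalForm`
(`GraphCanonization.lean`: a canonical form of vertex-coloured graphs computable in time
`2^{O(√N)}`) PROVED, by a Corneil–Goldberg-type canoniser:

* the canonical form is `CGCanon.cf (crRefiner k) G col` (`GraphCanonizationSchemeCorrect.lean`:
  colour-isomorphic to the input, equal on colour-isomorphic inputs), computed by the recursion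
  `CGCanon.canon` with sections along the components of the switched graph and individualization
  of a least big cell, whose recursion tree has at most `2^{14k+1}` nodes (`GraphCanonizationSchemeSize.lean`);
* the recursion runs as a stack machine (`GraphCanonizationMachine.lean`, `5 · cost` transitions),
  mirrored on lists (`GraphCanonizationProgramMachine.lean`) and typed polynomial time in the
  configuration (`codeFP_stepL`), every configuration of the genuine run of size `O(k⁵)`
  (`GraphCanonizationProgramSize.lean`);
* here: the whole program on the padded code `spad 18 (colGraphCode k G col)` — decode, iterate the
  guarded transition `|pad| ≥ 5 · 2^{14k+1}` times (`CodeFP.iterateInv` with the size invariant),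
  read the ordering off the finished configuration, emit the code of the input read along it — is
  in `FP` (`codeFP_outOf`), and the padding reduction `babaiLuks1983_canonicalForm_of_core` concludes.

## References

* L. Babai, E. M. Luks, *Canonical labeling of graphs*, STOC 1983, §4. [BabaiLuks1983]
* D. G. Corneil, M. K. Goldberg, *A non-factorial algorithm for canonical numbering of a graph*,
  J. Algorithms 5 (1984) 345–362. [CorneilGoldberg1984]
* B. Laubner, PhD thesis, HU Berlin 2011, doi:10.18452/16335, §3.4. [Laubner2011]
* S. Arora, B. Barak, *Computational Complexity: A Modern Approach*, CUP 2009, §1.3, §2.6. [AroraBarakCC2009]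
-/

namespace Literature.Computability.Complexity

open _root_.Computability CodeFP Polynomial CGCanon Finset

open scoped Classical

noncomputable section

namespace CGProg

/-! ### The program -/

/-- The configuration after `|pad|` guarded transitions. [folklore] -/
def cfgOf (s : PIn) : List LFrame := (stepOf s)^[s.1.length] (initOf s)

/-- **The output of the program.** [folklore] -/
def outOf (s : PIn) : GIn := outOf' s (headOrd (cfgOf s))

/-- The unary header is short. [folklore] -/
theorem nOf_le_length (s : PIn) : nOf s ≤ (pinE s).length := by
  obtain ⟨pad, g⟩ := s
  change g.2.1 ≤ (pairE strE ginE (pad, g)).length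
  rw [length_pairE_mk]
  exact (le_length_ginE g).trans (Nat.le_add_left _ _)

/-- **The run is typed polynomial time** — the iteration combinator with the size invariant: on a
valid input the configurations are those of the genuine run (`length_rawE_frameE_runL_le`), on an
invalid one the configuration never changes. [cite: AroraBarakCC2009, §1.3] -/
theorem codeFP_cfgOf : CodeFP pinE (rawE frameE) cfgOf := by
  obtain ⟨P, hP⟩ := exists_length_le_eval codeFP_initOf
  refine iterateInv (F := stepOf) (init := initOf) (k := fun s => s.1.length) (fun s j b => b = (stepOf s)^[j] (initOf s))
    codeFP_stepOf codeFP_initOf (strLength.comp (fst _ _)) (fun _ => rfl)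
    (fun s j b hb => by rw [hb]; exact (Function.iterate_succ_apply' _ _ _).symm) (P + C 5646 * (X + 1) ^ 5) (fun s j b hb => ?_)
  subst hb
  simp only [eval_add, eval_mul, eval_C, eval_pow, eval_X, eval_one]
  by_cases hv : validB s = true
  · -- the genuine run of a coloured graph
    obtain ⟨hrows, hcols⟩ := (validB_iff s).1 hv
    obtain ⟨G, hG⟩ := exists_adjOf_eq hrows
    obtain ⟨c, hc⟩ := exists_colOf_eq hcols
    have hstep : stepOf s = stepL (nOf s) (rowsOf s) := funext fun _ => if_pos hv
    have hrun : (stepOf s)^[j] (initOf s) = runL (nOf s) (adjOf G) j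
        [classifyL (nOf s) (adjOf G) (maskOf (univ : Finset (Fin (nOf s)))) (refineL (nOf s) (adjOf G) (maskOf (univ : Finset (Fin (nOf s)))) (colOf c))] := by
      rw [hstep, initOf, ← hG, ← hc, maskAll_eq]; rfl
    rw [hrun]
    have hn := nOf_le_length s
    calc _ ≤ 5646 * (nOf s + 1) ^ 5 := length_rawE_frameE_runL_le G c j
      _ ≤ 5646 * ((pinE s).length + j + 1) ^ 5 := Nat.mul_le_mul_left _ (Nat.pow_le_pow_left (by omega) 5)
      _ ≤ _ := Nat.le_add_left _ _
  · have hstep : stepOf s = id := funext fun _ => if_neg hv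
    rw [hstep, Function.iterate_id]
    calc _ ≤ P.eval (pinE s).length := hP s
      _ ≤ P.eval ((pinE s).length + j) := TM2Iter.eval_mono P (Nat.le_add_right _ _)
      _ ≤ _ := Nat.le_add_right _ _

/-- **The whole program is typed polynomial time.** [cite: AroraBarakCC2009, §1.3] -/
theorem codeFP_outOf : CodeFP pinE ginE outOf :=
  (codeFP_outOf'.comp ((CodeFP.id _).pair (codeFP_headOrd.comp codeFP_cfgOf))).congr fun _ => rfl

/-! ### On a genuine input -/

variable {k : ℕ} (G : SimpleGraph (Fin k)) (col : Fin k → ℕ)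

/-- The decoded padded code of a coloured graph. [folklore] -/
def pinOf : PIn := (padCore 18 (colGraphCode k G col), ((k, (adjOf G).flatten), (k, colOf col)))

/-- Its code is the padded code. [cite: AroraBarakCC2009, §2.6] -/
theorem pinE_pinOf : pinE (pinOf G col) = spad 18 (colGraphCode k G col) := by
  rw [spad_apply, pinOf]
  change boolPair (padCore 18 (colGraphCode k G col)) (ginE ((k, (adjOf G).flatten), (k, colOf col))) = _
  rw [colGraphCode_eq]

/-- Its rows are the rows of the graph. [folklore] -/
theorem rowsOf_pinOf : rowsOf (pinOf G col) = adjOf G := chunksL_flatten_adjOf G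

/-- It is valid. [folklore] -/
theorem validB_pinOf : validB (pinOf G col) = true :=
  (validB_iff _).2 ⟨by rw [rowsOf_pinOf]; exact rowsOK_adjOf G, length_colOf col⟩

/-- **Its final configuration is the canonical ordering** (the pad is long enough). [cite: Laubner2011, §3.4] -/
theorem cfgOf_pinOf : cfgOf (pinOf G col) = [LFrame.ret ((canonOrd (crRefiner k) G col).map Fin.val)] := by
  have hstep : stepOf (pinOf G col) = stepL k (adjOf G) := by
    funext cfg; rw [stepOf, if_pos (validB_pinOf G col), rowsOf_pinOf]; rfl
  unfold cfgOf
  rw [hstep, initOf, rowsOf_pinOf, maskAll_eq]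
  exact runL_root_of_le G col (five_mul_two_pow_le_length_padCore k G col)

/-- **Its output is the code of the canonical form.** [cite: BabaiLuks1983, §4] -/
theorem ginE_outOf_pinOf : ginE (outOf (pinOf G col)) = colGraphCode k (cf (crRefiner k) G col).1 (cf (crRefiner k) G col).2 := by
  rw [colGraphCode_cf, outOf, cfgOf_pinOf, headOrd_ret, outOf', rowsOf_pinOf]
  change ginE ((k, (codeL (adjOf G) (colOf col) _).1.flatten), (k, (codeL (adjOf G) (colOf col) _).2)) = _
  rw [codeL_canonOrd]

end CGProg

open CGProg in
/-- **Babai–Luks 1983 / Corneil–Goldberg 1984, discharged: canonical forms of vertex-coloured graphs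
are computable in time `2^{O(√N)}`** (`babaiLuks1983_canonicalForm` holds). [cite: BabaiLuks1983, Abstract and §4; CorneilGoldberg1984] -/
theorem babaiLuks1983_canonicalForm_holds : babaiLuks1983_canonicalForm := by
  obtain ⟨f, hf, hfs⟩ := codeFP_outOf
  have key : ∀ (k : ℕ) (G : SimpleGraph (Fin k)) (col : Fin k → ℕ),
      f (spad 18 (colGraphCode k G col)) = colGraphCode k (cf (crRefiner k) G col).1 (cf (crRefiner k) G col).2 := fun k G col => by
    rw [← pinE_pinOf, hfs, ginE_outOf_pinOf]
  exact babaiLuks1983_canonicalForm_of_core 18 hf (fun k G col => ⟨_, _, key k G col, cf_colIso⟩)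
    fun k G₁ c₁ G₂ c₂ h => by rw [key, key, cf_eq_of_colIso h]

end

end Literature.Computability.Complexity
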